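import Summits.ABC.IUTFork.Thm311Sig
import Mathlib.Logic.Relation
import Mathlib.Algebra.BigOperators.Finprod
import HarnessLib

/-!
# [IUTchIII] Theorem 3.11 in the author's terms, B: (i) Multiradial Representation — data (a)(b)(c), `R^LGP`, functoriality

Record-only file (D-0012) of the abc-iut cell (seat abc-iut-c312-1); TAKES NO SIDE. Sequel to
`Thm311Sig` (index data `ThetaIndex`, mono-analytic log-shell signature `LogShells`, tensor packets,
(Ind1), (Ind2)). This file types [IUTchIII] Theorem 3.11 (i) (kurims pp. 153–155), one declaration per
printed sub-item:

* `MRData L` — the data (a), (b), (c) of (i) for ONE vertical line `(n, ∘)` of the LGP-Gaussian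
  log-theta-lattice, on the mono-analytic packets of `L`:
  (a) the integral structures `I(^{S^±_{j+1}};^{n,∘}D⊢_{v_ℚ}) ⊆ I^ℚ(…)`, `I(^{S^±_{j+1},j};^{n,∘}D⊢_v) ⊆ I^ℚ(…)`
  "equipped with the procession-normalized mono-analytic log-volumes of Proposition 3.9, (ii)";
  (b) for `v ∈ V^bad` the splitting monoid `Ψ^⊥_{LGP}(^{n,∘}HT^{D-Θ±ell NF})_v` "as a subset of
  `∏_{j ∈ F_l^⋇} I^ℚ(^{S^±_{j+1},j};^{n,∘}D⊢_v)` equipped with a(n) [multiplicative] action on" that product;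
  (c) for `j ∈ F_l^⋇` "the number field `M^⊛_MOD(…)_j = M^⊛_mod(…)_j ⊆ I^ℚ(^{S^±_{j+1}};^{n,∘}D⊢_{V_ℚ}) :=
  ∏_{v_ℚ ∈ V_ℚ} I^ℚ(^{S^±_{j+1}};^{n,∘}D⊢_{v_ℚ})`".
* `MRData.map` — how a family of packet automorphisms transports (a)(b)(c); `IndMoves` = transport by an
  element of (Ind1) (one permutation per label, shared by all `v_ℚ`) or of (Ind2); `RLGP D` := "the
  collection of data (a), (b), (c) regarded up to indeterminacies of the following two types: (Ind1) …
  (Ind2) …" = the class of `D` under the equivalence relation generated by the moves.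
* `GlobalDegrees` — SIGNATURE for the global realified Frobenioids `F^⊛ℝ_MOD,j ⥲ F^⊛ℝ_mod,j` of (c)
  ([IUTchIII] Prop. 3.7, 3.10 (i); Ex. 3.6) with their degree; `DegreesViaLogvol` = (c)'s clause "whose
  associated "global degrees" may be computed by means of the log-volumes of (a) [cf. Proposition 3.9,
  (iii)]" as a named `Prop`.
* `Situation` — "the situation of Theorem 3.11" as far as (i) is concerned: initial Θ-index data, the
  bi-coric mono-analytic containers, and for every `n ∈ ℤ` the data (a)(b)(c) of the vertical line `n`;
  `Situation.MultiradialCompat` = the concluding assertion of (i): "`^{n,∘}R^{LGP}` may be constructed via an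
  algorithm in the procession of `D⊢`-prime-strips `Prc(^{n,∘}D⊢_T)` that is functorial with respect to
  isomorphisms of processions of `D⊢`-prime-strips. For `n, n' ∈ ℤ`, the permutation symmetries of the
  étale-picture … induce compatible poly-isomorphisms `Prc(^{n,∘}D⊢_T) ⥲ Prc(^{n',∘}D⊢_T)`;
  `^{n,∘}R^{LGP} ⥲ ^{n',∘}R^{LGP}` …" — typed, in the bi-coric strictification of `Thm311Sig` (one carrier
  per `v`, all vertical lines' `D⊢`-prime-strips acting on it through the full poly-isomorphisms of
  Thm. 1.5 (ii)–(iv)), as EQUALITY OF THE CLASSES `RLGP (D n) = RLGP (D n')`. HYPOTHESIS, never asserted.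

Modelling notes. The "algorithm" content of (i) — that (b) and (c), which a priori live in the arithmetic
holomorphic structure of the line `n`, are expressed on MONO-ANALYTIC containers — is represented by the
very type of `MRData L`: all of (a)(b)(c) is data on the packets of the `D⊢`-log-shells `L`. The
compatibility "with the poly-isomorphisms `^{n,∘}D⊢_0 ⥲ ^{n',∘}D⊢_0` induced by the bi-coricity
poly-isomorphisms of Theorem 1.5, (iii)" is a constraint on INSTANTIATION of `L` (its carriers are the
bi-coric log-shells of Thm. 1.5 (iv)), recorded in `LogShells`' docstring, not a separate `Prop`.
Whether (Ind1)/(Ind2) preserve log-volumes is NOT assumed (`LogvolInvariant` names it).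

Sources read on the page: [IUTchIII] pp. 101–106 (Prop. 3.4, 3.5), 109–112 (Prop. 3.7, Def. 3.8),
115–117 (Prop. 3.9), 147–149 (Prop. 3.10), 153–155 (Thm. 3.11 (i)). [claim: Mochizuki2012, status: disputed]
Deliberately NOT here: (ii), (iii), (Ind3) (sequels `Thm311LogKummer`, `Thm311LinkCompat`); the Θ-pilot
object and Cor. 3.12's regions (bridge file to `ForkRegions.Cor312Setting`); any judgement.
-/

noncomputable section

namespace Summit.ABC

namespace IUTFork

namespace Thm311

variable {T : ThetaIndex}

namespace LogShells

variable (L : LogShells T)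

/-- Families of linear automorphisms of all the tensor packets `I^ℚ(^{S^±_{j+1}};D⊢_{v_ℚ})`, `j ∈ |F_l|`,
`v_ℚ ∈ V_ℚ` — the shape in which (Ind1), (Ind2) act on the data (a)(b)(c). [folklore] -/
abbrev PacketAut : Type := ∀ (j : T.Label) (vQ : T.VQ), L.Packet j vQ ≃ₗ[ℚ] L.Packet j vQ

/-- The product module `∏_{j ∈ F_l^⋇} I^ℚ(^{S^±_{j+1},j};D⊢_v)` in which (b) places the splitting monoid —
here the ambient `∏_{j ∈ F_l^⋇}` of the full packets at `v_ℚ = v_ℚ(v)` (the sub-packets are submodules,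
`LogShells.SubPacket`). [claim: Mochizuki2012, status: disputed] -/
abbrev StarPacket (v : T.V) : Type := ∀ j : T.LabelStar, L.Packet j.1 (T.over v)

/-- The product `I^ℚ(^{S^±_{j+1}};D⊢_{V_ℚ}) := ∏_{v_ℚ ∈ V_ℚ} I^ℚ(^{S^±_{j+1}};D⊢_{v_ℚ})` of (c).
[claim: Mochizuki2012, status: disputed] -/
abbrev GlobalPacket (j : T.Label) : Type := ∀ vQ : T.VQ, L.Packet j vQ

/-- A packet-automorphism family acts on `∏_{j ∈ F_l^⋇}` componentwise. [folklore] -/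
def starAut (Φ : L.PacketAut) (v : T.V) : L.StarPacket v ≃ₗ[ℚ] L.StarPacket v :=
  LinearEquiv.piCongrRight fun j => Φ j.1 (T.over v)

/-- A packet-automorphism family acts on `∏_{v_ℚ}` componentwise. [folklore] -/
def globalAut (Φ : L.PacketAut) (j : T.Label) : L.GlobalPacket j ≃ₗ[ℚ] L.GlobalPacket j :=
  LinearEquiv.piCongrRight fun vQ => Φ j vQ

end LogShells

/-! ## 1. The data (a), (b), (c) of Theorem 3.11 (i) for one vertical line -/

/-- **The data (a), (b), (c) of [IUTchIII] Theorem 3.11 (i)** for one vertical line `(n, ∘)`, on the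
mono-analytic tensor packets of `L` (p. 153–154):
"(a) for `V ∋ v | v_ℚ ∈ V_ℚ`, `j ∈ |F_l|`, the topological modules and mono-analytic integral structures
`I(^{S^±_{j+1}};^{n,∘}D⊢_{v_ℚ}) ⊆ I^ℚ(^{S^±_{j+1}};^{n,∘}D⊢_{v_ℚ})`; `I(^{S^±_{j+1},j};^{n,∘}D⊢_v) ⊆ I^ℚ(^{S^±_{j+1},j};^{n,∘}D⊢_v)`
… of Proposition 3.2, (ii) …, which we regard as equipped with the procession-normalized mono-analytic
log-volumes of Proposition 3.9, (ii) [`μ^log : M(I^ℚ(−)) → ℝ`, `M(−)` = "the set of nonempty compact open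
subsets" (non) / "compact closures of nonempty open subsets" (arc) — here the predicate `Adm`];
(b) for `V^bad ∋ v`, the splitting monoid `Ψ^⊥_{LGP}(^{n,∘}HT^{D-Θ±ell NF})_v` of Proposition 3.5, (ii),
(c) …, which we regard — via the natural poly-isomorphisms `I^ℚ(^{S^±_{j+1},j};^{n,∘}D⊢_v) ⥲
I^ℚ(^{S^±_{j+1},j}F⊢×μ(^{n,∘}D_≻)_v) ⥲ I^ℚ(^{S^±_{j+1},j}F(^{n,∘}D_≻)_v)` for `j ∈ F_l^⋇` — as a subset of
`∏_{j ∈ F_l^⋇} I^ℚ(^{S^±_{j+1},j};^{n,∘}D⊢_v)`, equipped with a(n) [multiplicative] action on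
`∏_{j ∈ F_l^⋇} I^ℚ(^{S^±_{j+1},j};^{n,∘}D⊢_v)`;
(c) for `j ∈ F_l^⋇`, the number field `M^⊛_MOD(^{n,∘}HT^{D-Θ±ell NF})_j = M^⊛_mod(^{n,∘}HT^{D-Θ±ell NF})_j ⊆
I^ℚ(^{S^±_{j+1}};^{n,∘}D⊢_{V_ℚ}) := ∏_{v_ℚ ∈ V_ℚ} I^ℚ(^{S^±_{j+1}};^{n,∘}D⊢_{v_ℚ})` …".
HYPOTHESIS structure: objects only; no claim. The ring/field structures (multiplication of the packets,
the field structure of `M^⊛_mod`) enter only through the action `act` and are otherwise not modelled.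
TODO-merge: abc-iut-L6-t4 ([IUTchIII] Prop. 3.2 (ii), 3.5 (ii)(c), 3.9 (ii)(iii), 3.10 (i)).
[claim: Mochizuki2012, status: disputed] -/
structure MRData (L : LogShells T) where
  /-- (a) `I(^{S^±_{j+1}};D⊢_{v_ℚ}) ⊆ I^ℚ(^{S^±_{j+1}};D⊢_{v_ℚ})` -/
  shellPk : ∀ (j : T.Label) (vQ : T.VQ), Set (L.Packet j vQ)
  /-- (a) `I(^{S^±_{j+1},j};D⊢_v) ⊆ I^ℚ(^{S^±_{j+1},j};D⊢_v)` (inside the sub-packet at `v`) -/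
  shellSub : ∀ (j : T.Label) (v : T.V), Set (L.Packet j (T.over v))
  /-- (a) `M(I^ℚ(^{S^±_{j+1}};D⊢_{v_ℚ}))`: the regions carrying a log-volume -/
  Adm : ∀ (j : T.Label) (vQ : T.VQ), Set (L.Packet j vQ) → Prop
  /-- (a) the procession-normalized mono-analytic log-volume `μ^log_{S^±_{j+1},v_ℚ}` (Prop. 3.9 (ii)) -/
  logvol : ∀ (j : T.Label) (vQ : T.VQ), Set (L.Packet j vQ) → ℝ
  /-- (b) the splitting monoid `Ψ^⊥_{LGP}(^{n,∘}HT)_v ⊆ ∏_{j ∈ F_l^⋇} I^ℚ(^{S^±_{j+1},j};D⊢_v)`, `v ∈ V^bad` -/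
  Ψ : ∀ v : T.V, v ∈ T.Vbad → Set (L.StarPacket v)
  /-- (b) its "[multiplicative] action on `∏_{j ∈ F_l^⋇} I^ℚ(^{S^±_{j+1},j};D⊢_v)`" (used on `Ψ` only) -/
  act : ∀ v : T.V, v ∈ T.Vbad → L.StarPacket v → Module.End ℚ (L.StarPacket v)
  /-- (c) the number field `M^⊛_MOD,j = M^⊛_mod,j ⊆ ∏_{v_ℚ} I^ℚ(^{S^±_{j+1}};D⊢_{v_ℚ})`, `j ∈ F_l^⋇` -/
  Mmod : ∀ j : T.LabelStar, Set (L.GlobalPacket j.1)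

namespace MRData

variable {L : LogShells T} (D : MRData L)

/-- (b) places the splitting monoid inside the product of the SUB-packets `I^ℚ(^{S^±_{j+1},j};D⊢_v)`
(named condition; part of what an instantiation must check). [claim: Mochizuki2012, status: disputed] -/
def PsiInSubPackets : Prop :=
  ∀ (v : T.V) (hv : v ∈ T.Vbad), ∀ x ∈ D.Ψ v hv, ∀ j : T.LabelStar, x j ∈ L.SubPacket j.1 v

/-- TRANSPORT of the data (a)(b)(c) along a family `Φ` of packet automorphisms: integral structures and
the number fields go to their images, admissibility and log-volume are pulled back along `Φ⁻¹`, the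
splitting monoid goes to its image and its action is conjugated. This is how "the indeterminacies
induced by" (Ind1), (Ind2) act on `(a), (b), (c)`. [folklore] -/
def map (Φ : L.PacketAut) : MRData L where
  shellPk j vQ := Φ j vQ '' D.shellPk j vQ
  shellSub j v := Φ j (T.over v) '' D.shellSub j v
  Adm j vQ A := D.Adm j vQ ((Φ j vQ).symm '' A)
  logvol j vQ A := D.logvol j vQ ((Φ j vQ).symm '' A)
  Ψ v hv := L.starAut Φ v '' D.Ψ v hv
  act v hv y :=
    (L.starAut Φ v).toLinearMap ∘ₗ D.act v hv ((L.starAut Φ v).symm y) ∘ₗ (L.starAut Φ v).symm.toLinearMap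
  Mmod j := L.globalAut Φ j.1 '' D.Mmod j

/-! ## 2. `R^LGP`: the data regarded up to (Ind1), (Ind2) -/

/-- The families of packet automorphisms by which (Ind1) acts on the data: at EACH label `j` an element of
`LogShells.Ind1 j` (one permutation of `S^±_{j+1}` for all `v_ℚ`, strip-automorphisms per factor and
summand). [claim: Mochizuki2012, status: disputed] -/
def _root_.Summit.ABC.IUTFork.Thm311.LogShells.Ind1Family (L : LogShells T) : Set L.PacketAut :=
  {Φ | ∀ j, (fun vQ => Φ j vQ) ∈ L.Ind1 j}

/-- The families by which (Ind2) acts: at each `(j, v_ℚ)` an element of `LogShells.Ind2 j v_ℚ`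
("independent copies of Ism", independently at every place). [claim: Mochizuki2012, status: disputed] -/
def _root_.Summit.ABC.IUTFork.Thm311.LogShells.Ind2Family (L : LogShells T) : Set L.PacketAut :=
  {Φ | ∀ j vQ, Φ j vQ ∈ L.Ind2 j vQ}

/-- One INDETERMINACY MOVE: transport of the data by an (Ind1)-family or by an (Ind2)-family. [folklore] -/
def IndMoves (D D' : MRData L) : Prop :=
  ∃ Φ : L.PacketAut, (Φ ∈ L.Ind1Family ∨ Φ ∈ L.Ind2Family) ∧ D' = D.map Φ

/-- **`^{n,∘}R^{LGP}`** ([IUTchIII] Thm. 3.11 (i), p. 154): "Write `^{n,∘}R^{LGP}` for the collection of data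
(a), (b), (c) regarded up to indeterminacies of the following two types: (Ind1) … (Ind2) …" — the class
of the data under the equivalence relation generated by the indeterminacy moves.
[claim: Mochizuki2012, status: disputed] -/
def RLGP (D : MRData L) : Set (MRData L) := {D' | Relation.EqvGen IndMoves D D'}

/-- The data itself is one of its possible images. [folklore] -/
theorem mem_RLGP_self : D ∈ D.RLGP := Relation.EqvGen.refl D

/-- `R^LGP` is a CLASS: two data have the same `R^LGP` iff they are related by indeterminacy moves.
[folklore] -/
theorem RLGP_eq_iff (D D' : MRData L) : D.RLGP = D'.RLGP ↔ Relation.EqvGen IndMoves D D' := by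
  constructor
  · intro h
    have : D' ∈ D.RLGP := by rw [h]; exact D'.mem_RLGP_self
    exact this
  · intro h
    ext E
    exact ⟨fun hE => Relation.EqvGen.trans _ _ _ (Relation.EqvGen.symm _ _ h) hE,
      fun hE => Relation.EqvGen.trans _ _ _ h hE⟩

/-- The identity family is an (Ind2)-family (and an (Ind1)-family): the trivial move is allowed. [folklore] -/
theorem refl_mem_Ind2Family : (fun j vQ => LinearEquiv.refl ℚ (L.Packet j vQ)) ∈ L.Ind2Family :=
  fun j vQ => L.refl_mem_Ind2 j vQ

/-- The identity family is an (Ind1)-family. [folklore] -/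
theorem refl_mem_Ind1Family : (fun j vQ => LinearEquiv.refl ℚ (L.Packet j vQ)) ∈ L.Ind1Family :=
  fun j => L.refl_mem_Ind1 j

/-- A property of the data is WELL-DEFINED ON `R^LGP` iff it is invariant under the indeterminacy moves —
the form in which every downstream use of the multiradial representation (log-volumes of possible images,
[IUTchIII] Cor. 3.12; [IUTchIV] Thm. 1.10 Step (v)) consumes (Ind1), (Ind2). [folklore] -/
theorem wellDefined_on_RLGP {P : MRData L → Prop} (hP : ∀ D D' : MRData L, IndMoves D D' → (P D ↔ P D'))
    {D D' : MRData L} (h : D' ∈ D.RLGP) : P D ↔ P D' := by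
  induction h with
  | rel x y hxy => exact hP x y hxy
  | refl x => exact Iff.rfl
  | symm x y _ ih => exact ih.symm
  | trans x y z _ _ ih1 ih2 => exact ih1.trans ih2

/-- `LogvolInvariant D` := the log-volumes of (a) are unchanged by every indeterminacy move out of `D`
(what [IUTchIV] Thm. 1.10 Step (v) uses of (Ind1), (Ind2): permutations of tensor factors and
isometries preserve the normalized log-volume). NOT assumed anywhere; named so that instantiations state
and prove it (cf. `ForkInflation.IndData.representedVol_iff_of_preserving`). [claim: Mochizuki2012, status: disputed] -/
def LogvolInvariant : Prop :=
  ∀ Φ : L.PacketAut, (Φ ∈ L.Ind1Family ∨ Φ ∈ L.Ind2Family) →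
    ∀ j vQ (A : Set (L.Packet j vQ)), D.Adm j vQ A → D.logvol j vQ (Φ j vQ '' A) = D.logvol j vQ A

end MRData

/-! ## 3. (c)'s global degrees, and the situation of Theorem 3.11 (i) -/

/-- SIGNATURE for the GLOBAL REALIFIED FROBENIOIDS of (c) at one vertical line and one label `j ∈ F_l^⋇`:
"natural isomorphisms between the associated global non-realified/realified Frobenioids
`F^⊛_MOD(^{n,∘}HT^{D-Θ±ell NF})_j ⥲ F^⊛_mod(^{n,∘}HT^{D-Θ±ell NF})_j`; `F^⊛ℝ_MOD(…)_j ⥲ F^⊛ℝ_mod(…)_j`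
[cf. Proposition 3.10, (i)]" — objects (isomorphism classes) of the two non-realified Frobenioids with the
natural identification, the degree of their realifications, and, for an object `J = {J_v}_{v ∈ V}` of
`F^⊛_mod,j` ([IUTchIII] Ex. 3.6 (ii): collections of local fractional ideals), the region of
`∏_{v_ℚ} I^ℚ(^{S^±_{j+1}};D⊢_{v_ℚ})` it determines ("the elements of "`M(−)`" determined by objects `J`",
Prop. 3.9 (iii)). TODO-merge: abc-iut-L6-t4 ([IUTchIII] Ex. 3.6, Prop. 3.7, 3.10 (i)).
[claim: Mochizuki2012, status: disputed] -/
structure GlobalDegrees (L : LogShells T) (j : T.LabelStar) where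
  /-- objects of `F^⊛_MOD,j` (up to isomorphism) -/
  ObjMOD : Type
  /-- objects of `F^⊛_mod,j` (up to isomorphism) -/
  Objmod : Type
  /-- the natural isomorphism `F^⊛_MOD,j ⥲ F^⊛_mod,j` on objects -/
  natIso : ObjMOD ≃ Objmod
  /-- degree of the image in the realification `F^⊛ℝ_mod,j` (an arithmetic degree, `ℝ`-valued) -/
  deg : Objmod → ℝ
  /-- the region of `∏_{v_ℚ} I^ℚ(^{S^±_{j+1}};D⊢_{v_ℚ})` determined by an object `J = {J_v}` -/
  region : Objmod → ∀ vQ : T.VQ, Set (L.Packet j.1 vQ)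

/-- **(c), degree clause** ([IUTchIII] Thm. 3.11 (i) (c)): "… whose associated "global degrees" may be
computed by means of the log-volumes of (a) [cf. Proposition 3.9, (iii)]" — Prop. 3.9 (iii): "by adding
the log-volumes … [all but finitely many of which are zero!] at the various `v_ℚ ∈ V_ℚ`, one obtains a
global log-volume … the global log-volume `μ^log_{A,V_ℚ}(J)` is equal to the degree of the arithmetic line
bundle determined by `J` …, relative to a suitable normalization". Typed: every region of an object is
admissible with finitely many nonzero local log-volumes, and its degree is their sum. HYPOTHESIS.
[claim: Mochizuki2012, status: disputed] -/
def DegreesViaLogvol {L : LogShells T} (D : MRData L) (G : ∀ j : T.LabelStar, GlobalDegrees L j) : Prop :=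
  ∀ (j : T.LabelStar) (J : (G j).Objmod),
    (∀ vQ, D.Adm j.1 vQ ((G j).region J vQ)) ∧
    {vQ | D.logvol j.1 vQ ((G j).region J vQ) ≠ 0}.Finite ∧
    (G j).deg J = ∑ᶠ vQ, D.logvol j.1 vQ ((G j).region J vQ)

/-- **"The situation of Theorem 3.11"**, (i)-part ([IUTchIII] Thm. 3.11, p. 153: "Fix a collection of
initial Θ-data … Let `{^{n,m}HT^{Θ±ell NF}}_{n,m ∈ ℤ}` be a collection of distinct `Θ±ell NF`-Hodge theaters
… arising from an LGP-Gaussian log-theta-lattice [cf. Definition 3.8, (iii)]. For each `n ∈ ℤ`, write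
`^{n,∘}HT^{D-Θ±ell NF}` for the `D-Θ±ell NF`-Hodge theater determined, up to isomorphism, by the various
`^{n,m}HT^{Θ±ell NF}`, where `m ∈ ℤ`, via the vertical coricity of Theorem 1.5, (i)"): the index data, the
bi-coric mono-analytic log-shells (one `LogShells`, on which every vertical line's procession
`Prc(^{n,∘}D⊢_T)` acts — Thm. 1.5 (ii)–(iv), Cor. 2.3 (ii) "`^{∘,∘}C`"), for every `n ∈ ℤ` the data (a)(b)(c)
of the line `n`, and the global Frobenioid signatures of (c). The Hodge theaters themselves are campaign-M
objects (TODO-merge: abc-iut-L5-t4 [IUTchI] Def. 6.13; abc-iut-L6-t4 [IUTchIII] Def. 3.8 (iii)).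
[claim: Mochizuki2012, status: disputed] -/
structure Situation (T : ThetaIndex) where
  /-- the bi-coric mono-analytic log-shells -/
  L : LogShells T
  /-- the data (a), (b), (c) of the vertical line `n`, for every `n ∈ ℤ` -/
  D : ℤ → MRData L
  /-- the global Frobenioids of (c) of the vertical line `n` at label `j` -/
  G : ∀ (n : ℤ) (j : T.LabelStar), GlobalDegrees L j

namespace Situation

variable (S : Situation T)

/-- `^{n,∘}R^{LGP}` of the situation. [claim: Mochizuki2012, status: disputed] -/
def RLGP (n : ℤ) : Set (MRData S.L) := (S.D n).RLGP

/-- **Theorem 3.11 (i), concluding assertion** (p. 154–155): "Then `^{n,∘}R^{LGP}` may be constructed via an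
algorithm in the procession of `D⊢`-prime-strips `Prc(^{n,∘}D⊢_T)` that is functorial with respect to
isomorphisms of processions of `D⊢`-prime-strips. For `n, n' ∈ ℤ`, the permutation symmetries of the
étale-picture discussed in [IUTchI], Corollary 6.10, (iii); [IUTchII], Corollary 4.11, (ii), (iii) [cf.
also Corollary 2.3, (ii); Remarks 2.3.2 and 3.8.2, of the present paper], induce compatible
poly-isomorphisms `Prc(^{n,∘}D⊢_T) ⥲ Prc(^{n',∘}D⊢_T)`; `^{n,∘}R^{LGP} ⥲ ^{n',∘}R^{LGP}` which are, moreover,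
compatible with the poly-isomorphisms `^{n,∘}D⊢_0 ⥲ ^{n',∘}D⊢_0` induced by the bi-coricity poly-isomorphisms
of Theorem 1.5, (iii) [cf. also [IUTchII], Corollaries 4.10, (iv); 4.11, (i)]."
READING in the bi-coric strictification (all processions act on the same carriers, the induced
poly-isomorphism `Prc(^{n,∘}D⊢_T) ⥲ Prc(^{n',∘}D⊢_T)` being the full set of procession automorphisms =
(Ind1)): the classes coincide, `^{n,∘}R^{LGP} = ^{n',∘}R^{LGP}`. HYPOTHESIS, never asserted here.
[claim: Mochizuki2012, status: disputed] -/
@[claim "Mochizuki2012" "disputed"] def MultiradialCompat : Prop := ∀ n n' : ℤ, S.RLGP n = S.RLGP n'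

/-- **Theorem 3.11 (i) (c), degree clause**, at every vertical line. HYPOTHESIS.
[claim: Mochizuki2012, status: disputed] -/
@[claim "Mochizuki2012" "disputed"] def DegreeClause : Prop := ∀ n : ℤ, DegreesViaLogvol (S.D n) (S.G n)

/-- **Theorem 3.11 (i)** as one `Prop`: the splitting monoids sit in the sub-packets, the degree clause of
(c), and the multiradial compatibility of the classes `^{n,∘}R^{LGP}`. HYPOTHESIS, never asserted here.
[claim: Mochizuki2012, status: disputed] -/
@[claim "Mochizuki2012" "disputed"] def PartI : Prop :=
  (∀ n : ℤ, (S.D n).PsiInSubPackets) ∧ S.DegreeClause ∧ S.MultiradialCompat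

/-- Under (i), membership of the line-`n'` data in `^{n,∘}R^{LGP}`: the data of ANY vertical line is one of
the possible images of the data of any other — the form used by Cor. 3.12 ("the union of the possible
images of a Θ-pilot object … in the multiradial representation of Theorem 3.11, (i), which we regard as
subject to the indeterminacies (Ind1), (Ind2), (Ind3)"). [claim: Mochizuki2012, status: disputed] -/
theorem mem_RLGP_of_multiradialCompat (h : S.MultiradialCompat) (n n' : ℤ) : S.D n' ∈ S.RLGP n := by
  rw [h n n']; exact (S.D n').mem_RLGP_self

/-- Under (i), a move-invariant property holds for the data of one vertical line iff it holds for the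
data of any other. [folklore] -/
theorem invariant_iff_of_multiradialCompat (h : S.MultiradialCompat) {P : MRData S.L → Prop}
    (hP : ∀ D D' : MRData S.L, MRData.IndMoves D D' → (P D ↔ P D')) (n n' : ℤ) :
    P (S.D n) ↔ P (S.D n') :=
  MRData.wellDefined_on_RLGP hP (S.mem_RLGP_of_multiradialCompat h n n')

end Situation

end Thm311

end IUTFork

end Summit.ABC

end
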